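import Literature.AlgebraicGeometry.HodgeTheory.UniversalHypersurfaceEhresmann
import Literature.AlgebraicGeometry.HodgeTheory.UniversalHypersurfaceDiscriminantExists
import Literature.AlgebraicTopology.SingularHomology.BettiNumberBaseChange
import Mathlib.Analysis.Normed.Module.Connected
import HarnessLib

/-!
# The Betti numbers of a smooth hypersurface of degree `d` in `ℙⁿ⁺¹` depend only on `(n, d)`
# (Ehresmann's theorem on the universal smooth hypersurface; Voisin I §9.1–9.2, Voisin II §6.2.1)

Family `hodge`, layer `Literature/AlgebraicGeometry/HodgeTheory`. PROOF FILE (theorems only: no definition, no named fact,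
no instance; D-0026 net debt `0`). C. Voisin, *Hodge Theory and Complex Algebraic Geometry I* (2002), Thm. 9.3
(Ehresmann) and §9.2.1: the fibres of a smooth proper family over a connected base are all diffeomorphic, so "we have
`dim Hᵏ(X_b, ℂ) = dim Hᵏ(X, ℂ) = b_k`" (proof of Prop. 9.20); *II* (2003), §6.2.1: "the universal smooth hypersurface
`π : 𝒴 → B`", `B ⊂ H⁰(ℙⁿ⁺¹, 𝒪(d))` the (connected) open set of smooth `f`. D. Eisenbud, J. Harris, *3264 and All That*
(2016), §5.7 Example 5.24 uses exactly this ("the Betti numbers of a smooth hypersurface of degree `d` in `ℙⁿ` […]").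

Everything is ASSEMBLED from tree theorems: the universal family `π = Motives.UniversalHypersurface.family ℂ n d` is
cohomologically locally trivial over all of `U(ℂ)` (`UniversalHypersurface.isCohomologicallyLocallyTrivialOn_family` —
Ehresmann, PROVED in the tree), so `Rᵏ π_* ℂ` is a local system with stalks `Hᵏ(Y_s(ℂ); ℂ)`
(`universalHypersurfaceLocalSystemOfEhresmann`); `U(ℂ)` is path connected (`pathConnectedSpace_complexPoints_base`,
`d ≥ 2`; for `d = 1` it is `ℂⁿ⁺² ∖ 0`, proved here); every smooth `X_F` is a fibre
(`Motives.UniversalHypersurface.exists_fiberOver_iso_hypersurface`).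

* `isNonsingularForm_formOfCoeffs_of_ne_zero_one`, `singularCoeffs_one_eq`, `pathConnectedSpace_complexPoints_base_one`
  — degree `1`: a non-zero linear form is nonsingular, so `U(ℂ) ≅ ℂⁿ⁺² ∖ {0}` is path connected;
  `pathConnectedSpace_complexPoints_base_of_one_le` — `U(ℂ)` is path connected for every `d ≥ 1`.
* `nonempty_linearEquiv_complexBetti_fiberOver_family` — **the stalks `Hᵏ(Y_s(ℂ); ℂ) ≃ Hᵏ(Y_t(ℂ); ℂ)`** of the local
  system along a path (transport is an isomorphism: the fundamental groupoid is a groupoid).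
* **`finrank_complexBetti_hypersurface_eq_of_isNonsingularForm`**, **`finrank_bettiCohomology_hypersurface_eq_of_isNonsingularForm`**
  — `b_k(X_F) = b_k(X_G)` for nonsingular forms `F`, `G` of the same degree `d ≥ 1` in `n + 2` variables (over `ℂ` and
  over `ℚ`).

Written by the prover seat `hodge-nonav-prover-Bx` (g10) for the discharge of the named fact
`EisenbudHarris2016_surface_secondBettiNumber` (K1-A binder B2 of route `HodgeConjecture/CyclicUnitaryPowers`): combined with
the Fermat value (`FermatEvenMiddleBettiNumber`) it gives `b₂` of every smooth surface in `ℙ³`.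

## References

* [VoisinHodgeI2002] C. Voisin, Hodge Theory and Complex Algebraic Geometry I, CUP 2002, Thm. 9.3, §9.2.1, Prop. 9.20 (proof).
* [VoisinHodgeII2003] C. Voisin, Hodge Theory and Complex Algebraic Geometry II, CUP 2003, §6.2.1.
* [EisenbudHarris2016] D. Eisenbud, J. Harris, 3264 and All That, CUP 2016, §5.7 Example 5.24.
* [Hartshorne1977] R. Hartshorne, Algebraic Geometry, Springer 1977, I Ex. 5.8–5.9 (Jacobian criterion for hypersurfaces).
-/

noncomputable section

open CategoryTheory AlgebraicGeometry MvPolynomial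
open _root_.Topology

namespace Literature.AlgebraicGeometry.HodgeTheory

open Literature.AlgebraicGeometry.Motives Literature.AlgebraicGeometry.Motives.UniversalHypersurface
open Literature.AlgebraicTopology.SingularHomology

universe u

variable {n d : ℕ}

/-! ### Degree one: `U(ℂ) = ℂⁿ⁺² ∖ {0}` is path connected -/

/-- An exponent vector of degree `1` is a coordinate vector `eᵢ`. [folklore] -/
private theorem exists_eq_single_of_degree_eq_one {σ : Type*} (m : σ →₀ ℕ) (hm : m.degree = 1) :
    ∃ i, m = Finsupp.single i 1 := by
  classical
  have hne : m ≠ 0 := by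
    intro h
    rw [h, map_zero] at hm
    exact zero_ne_one hm
  obtain ⟨i, hi⟩ := Finsupp.ne_iff.mp hne
  simp only [Finsupp.coe_zero, Pi.zero_apply] at hi
  refine ⟨i, ?_⟩
  rw [Finsupp.degree_apply] at hm
  have hsum : ∑ j ∈ m.support, m j = m i + ∑ j ∈ m.support.erase i, m j :=
    (Finset.add_sum_erase _ _ (Finsupp.mem_support_iff.mpr hi)).symm
  have hmi : m i = 1 := by omega
  have hrest : ∑ j ∈ m.support.erase i, m j = 0 := by omega
  ext j
  by_cases hji : j = i
  · subst hji
    rw [Finsupp.single_eq_same, hmi]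
  · rw [Finsupp.single_apply, if_neg (Ne.symm hji)]
    by_contra hj
    have hjmem : j ∈ m.support.erase i := Finset.mem_erase.mpr ⟨hji, Finsupp.mem_support_iff.mpr hj⟩
    exact hj (Finset.sum_eq_zero_iff.mp hrest j hjmem)

/-- **A non-zero LINEAR form is nonsingular** (degree `1`): if `a ≠ 0` then some `∂ᵢ(Σ a_m x^m) = a_{eᵢ}` is a non-zero
constant, hence a unit, so no prime ideal contains all the partials (Jacobian criterion, Hartshorne I Ex. 5.8: a
hyperplane is nonsingular). [cite: Hartshorne1977, I Ex. 5.8 and I Ex. 5.9] -/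
theorem isNonsingularForm_formOfCoeffs_of_ne_zero_one {a : DegIndex n 1 → ℂ} (ha : a ≠ 0) :
    SmoothHypersurface.IsNonsingularForm ℂ (formOfCoeffs a) := by
  classical
  obtain ⟨m, hm⟩ := Function.ne_iff.mp ha
  simp only [Pi.zero_apply] at hm
  obtain ⟨i, hi⟩ := exists_eq_single_of_degree_eq_one m.1 m.2
  -- `∂ᵢ F = C (a m)`
  have hderiv : pderiv i (formOfCoeffs a) = C (a m) := by
    rw [formOfCoeffs_def, map_sum]
    rw [Finset.sum_eq_single m]
    · rw [pderiv_monomial, hi, Finsupp.single_eq_same, Nat.cast_one, mul_one, tsub_self]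
      rfl
    · intro m' _ hm'
      obtain ⟨j, hj⟩ := exists_eq_single_of_degree_eq_one m'.1 m'.2
      have hji : j ≠ i := by
        intro hji
        apply hm'
        apply Subtype.ext
        rw [hj, hi, hji]
      rw [pderiv_monomial, hj, Finsupp.single_apply, if_neg hji, Nat.cast_zero, mul_zero, monomial_zero]
    · intro h
      exact absurd (Finset.mem_univ m) h
  intro 𝔭 h𝔭 _ hder
  exfalso
  have hunit : IsUnit (pderiv i (formOfCoeffs a)) := by
    rw [hderiv]
    exact (IsUnit.mk0 _ hm).map C
  exact h𝔭.ne_top (Ideal.eq_top_of_isUnit_mem 𝔭 (hder i) hunit)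

/-- **In degree `1` the singular coefficient vectors are exactly `{0}`**: the zero form is singular
(`zero_mem_singularCoeffs`) and every non-zero linear form is nonsingular. [cite: Hartshorne1977, I Ex. 5.8 and I Ex. 5.9] -/
theorem singularCoeffs_one_eq : singularCoeffs n 1 = {0} := by
  ext a
  rw [Set.mem_singleton_iff, mem_singularCoeffs_iff]
  refine ⟨fun h ↦ ?_, fun h ↦ ?_⟩
  · by_contra ha
    exact h (isNonsingularForm_formOfCoeffs_of_ne_zero_one ha)
  · rw [h]
    exact (mem_singularCoeffs_iff n 1 0).mp zero_mem_singularCoeffs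

/-- **`U(ℂ)` is path connected in degree `1`**: it is the image of `ℂⁿ⁺² ∖ {0}` (complement of a point in a complex vector
space of dimension `n + 2 ≥ 2`, path connected) under the continuous classifying map `a ↦ [Σ a_m x^m]`.
[cite: VoisinHodgeII2003, §6.2.1] -/
theorem pathConnectedSpace_complexPoints_base_one : PathConnectedSpace (ComplexPoints (base ℂ n 1)) := by
  -- `{0}ᶜ ⊆ ℂ^{DegIndex n 1}` is path connected: the real rank is `2 (n + 2) > 1`
  have hrank : 1 < Module.rank ℝ (DegIndex n 1 → ℂ) := by
    haveI : Nonempty (DegIndex n 1) := ⟨⟨Finsupp.single 0 1, by simp [Finsupp.degree_single]⟩⟩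
    obtain ⟨m₀⟩ := ‹Nonempty (DegIndex n 1)›
    have h2 : Module.rank ℝ ℂ ≤ Module.rank ℝ (DegIndex n 1 → ℂ) :=
      LinearMap.rank_le_of_injective (LinearMap.single ℝ (fun _ : DegIndex n 1 => ℂ) m₀)
        (LinearMap.ker_eq_bot.mp (LinearMap.ker_single ℝ (fun _ : DegIndex n 1 => ℂ) m₀))
    rw [Complex.rank_real_complex] at h2
    exact lt_of_lt_of_le (by norm_num) h2
  have hS : IsPathConnected (singularCoeffs n 1)ᶜ := by
    rw [singularCoeffs_one_eq]
    exact isPathConnected_compl_singleton_of_one_lt_rank hrank 0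
  have hJ : ∀ a : ↥(singularCoeffs n 1)ᶜ,
      SmoothHypersurface.IsNonsingularForm ℂ (formOfCoeffs (a.1 : DegIndex n 1 → ℂ)) := fun a =>
    not_not.mp a.2
  have hcont : Continuous fun a : ↥(singularCoeffs n 1)ᶜ => pointOfCoeffs ℂ n 1 a.1 (hJ a) :=
    continuous_pointOfCoeffs_comp ℂ n 1 continuous_subtype_val hJ
  haveI : PathConnectedSpace ↥(singularCoeffs n 1)ᶜ := isPathConnected_iff_pathConnectedSpace.mp hS
  have hrange : Set.range (fun a : ↥(singularCoeffs n 1)ᶜ => pointOfCoeffs ℂ n 1 a.1 (hJ a)) = Set.univ := by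
    refine Set.eq_univ_of_forall fun s => ?_
    have hs : coeffVector ℂ n 1 s ∈ (singularCoeffs n 1)ᶜ := by
      rw [compl_singularCoeffs_eq_range_coeffVector]
      exact ⟨s, rfl⟩
    exact ⟨⟨coeffVector ℂ n 1 s, hs⟩, pointOfCoeffs_coeffVector ℂ n 1 s _⟩
  rw [pathConnectedSpace_iff_univ, ← hrange]
  exact isPathConnected_range hcont

/-- **`U(ℂ)` is path connected for every degree `d ≥ 1`** (`d = 1`: above; `d ≥ 2`: the complement of the irreducible
discriminant hypersurface, the tree's `pathConnectedSpace_complexPoints_base`). [cite: VoisinHodgeII2003, §6.2.1] -/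
theorem pathConnectedSpace_complexPoints_base_of_one_le (hd : 1 ≤ d) : PathConnectedSpace (ComplexPoints (base ℂ n d)) := by
  by_cases h1 : d = 1
  · subst h1
    exact pathConnectedSpace_complexPoints_base_one
  · exact pathConnectedSpace_complexPoints_base (n := n) (by omega)

/-! ### The stalks of `Rᵏ π_* ℂ` are all isomorphic -/

/-- **The cohomology of two fibres of the universal smooth hypersurface is isomorphic**: for `s, t ∈ U(ℂ)` (`d ≥ 1`)
there is a `ℂ`-linear isomorphism `Hᵏ(Y_s(ℂ); ℂ) ≃ Hᵏ(Y_t(ℂ); ℂ)` — parallel transport in the local system `Rᵏ π_* ℂ`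
(Ehresmann, `universalHypersurfaceLocalSystemOfEhresmann`) along a path from `s` to `t` (`U(ℂ)` is path connected), an
isomorphism because the fundamental groupoid is a groupoid. [cite: VoisinHodgeI2002, Thm. 9.3 and §9.2.1]
[cite: VoisinHodgeII2003, §6.2.1] -/
theorem nonempty_linearEquiv_complexBetti_fiberOver_family (hd : 1 ≤ d) (s t : ComplexPoints (base ℂ n d)) (k : ℕ) :
    Nonempty (complexBetti (fiberOver (family ℂ n d) s) k ≃ₗ[ℂ] complexBetti (fiberOver (family ℂ n d) t) k) := by
  haveI := pathConnectedSpace_complexPoints_base_of_one_le (n := n) hd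
  let γ : Path s t := PathConnectedSpace.somePath s t
  let V := UniversalHypersurface.universalHypersurfaceLocalSystemOfEhresmann n d k hd
  let f : FundamentalGroupoid.mk s ⟶ FundamentalGroupoid.mk t := FundamentalGroupoid.fromPath ⟦γ⟧
  exact ⟨(asIso (V.map f)).toLinearEquiv⟩

/-! ### The Betti numbers of `X_F` depend only on the degree -/

/-- Betti numbers are isomorphism invariants (`e^*` is a linear isomorphism; plumbing). [folklore] -/
private theorem finrank_complexBetti_eq_of_iso' {X Y : SchemeOver ℂ} (e : X ≅ Y) (i : ℕ) :
    Module.finrank ℂ (complexBetti X i) = Module.finrank ℂ (complexBetti Y i) := by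
  refine LinearEquiv.finrank_eq (LinearEquiv.ofLinear (complexBetti.map e.inv i).hom (complexBetti.map e.hom i).hom ?_ ?_)
  · rw [← ModuleCat.hom_comp, ← complexBetti.map_comp, e.inv_hom_id, complexBetti.map_id]
    rfl
  · rw [← ModuleCat.hom_comp, ← complexBetti.map_comp, e.hom_inv_id, complexBetti.map_id]
    rfl

/-- **`b_k(X_F) = b_k(X_G)` for nonsingular forms `F`, `G` of the same degree `d ≥ 1` in `n + 2` variables** (over `ℂ`):
both `X_F` and `X_G` are fibres of the universal smooth hypersurface `π : 𝒴_U → U` (`exists_fiberOver_iso_hypersurface`),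
whose fibres over the path-connected `U(ℂ)` have isomorphic cohomology (Ehresmann). This is "the Betti numbers of a smooth
hypersurface of degree `d` in `ℙⁿ`" being well defined. [cite: VoisinHodgeI2002, Thm. 9.3, §9.2.1 and Prop. 9.20 (proof)]
[cite: VoisinHodgeII2003, §6.2.1] [cite: EisenbudHarris2016, Example 5.24] -/
theorem finrank_complexBetti_hypersurface_eq_of_isNonsingularForm (hd : 1 ≤ d) {F G : MvPolynomial (Fin (n + 2)) ℂ}
    (hF : F.IsHomogeneous d) (hFns : SmoothHypersurface.IsNonsingularForm ℂ F)
    (hG : G.IsHomogeneous d) (hGns : SmoothHypersurface.IsNonsingularForm ℂ G) (k : ℕ) :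
    Module.finrank ℂ (complexBetti (SmoothHypersurface.hypersurface F) k) =
      Module.finrank ℂ (complexBetti (SmoothHypersurface.hypersurface G) k) := by
  obtain ⟨s, ⟨eF⟩⟩ := exists_fiberOver_iso_hypersurface ℂ n d (by omega) hF hFns
  obtain ⟨t, ⟨eG⟩⟩ := exists_fiberOver_iso_hypersurface ℂ n d (by omega) hG hGns
  obtain ⟨φ⟩ := nonempty_linearEquiv_complexBetti_fiberOver_family (n := n) hd s t k
  rw [← finrank_complexBetti_eq_of_iso' eF k, ← finrank_complexBetti_eq_of_iso' eG k]
  exact φ.finrank_eq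

/-- **`b_k(X_F) = b_k(X_G)` over `ℚ`** for nonsingular forms of the same degree `d ≥ 1` (universal coefficients:
`dim_ℚ Hᵏ(X(ℂ); ℚ) = dim_ℂ Hᵏ(X(ℂ); ℂ)`). [cite: VoisinHodgeI2002, Thm. 9.3, §9.2.1 and Prop. 9.20 (proof)]
[cite: EisenbudHarris2016, Example 5.24] -/
theorem finrank_bettiCohomology_hypersurface_eq_of_isNonsingularForm (hd : 1 ≤ d) {F G : MvPolynomial (Fin (n + 2)) ℂ}
    (hF : F.IsHomogeneous d) (hFns : SmoothHypersurface.IsNonsingularForm ℂ F)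
    (hG : G.IsHomogeneous d) (hGns : SmoothHypersurface.IsNonsingularForm ℂ G) (k : ℕ) :
    Module.finrank ℚ (bettiCohomology (SmoothHypersurface.hypersurface F) k) =
      Module.finrank ℚ (bettiCohomology (SmoothHypersurface.hypersurface G) k) := by
  have h := finrank_complexBetti_hypersurface_eq_of_isNonsingularForm (n := n) hd hF hFns hG hGns k
  change Module.finrank ℂ (singularCohomology ℂ ℂ (ComplexPoints (SmoothHypersurface.hypersurface F)) k) =
    Module.finrank ℂ (singularCohomology ℂ ℂ (ComplexPoints (SmoothHypersurface.hypersurface G)) k) at h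
  change Module.finrank ℚ (singularCohomology ℚ ℚ (ComplexPoints (SmoothHypersurface.hypersurface F)) k) =
    Module.finrank ℚ (singularCohomology ℚ ℚ (ComplexPoints (SmoothHypersurface.hypersurface G)) k)
  rw [finrank_singularCohomology_eq_bettiNumber_of_field, finrank_singularCohomology_eq_bettiNumber_of_field] at h ⊢
  rw [bettiNumber_eq_of_algebra ℚ ℂ, bettiNumber_eq_of_algebra ℚ ℂ, h]

end Literature.AlgebraicGeometry.HodgeTheory

end
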